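import Mathlib
import HarnessLib
import Literature.Probability.Distributions.GaussianMetropolisAcceptance

/-!
# Gaussian log-noise in the pseudo-marginal algorithm: the tilted noise law and `2Φ(−σ/√2)`

HONEST FRAMING: exact (Metropolis-corrected) sampling algorithms for lattice gauge theory;
figures of merit are autocorrelation/cost numbers at stated couplings and volumes; no
continuum-physics claim.

Topic `Probability/Distributions`.  PUBLISHED RESULT with our formalisation of the printed
computation; no named fact is introduced.

Source: A. Doucet, M. K. Pitt, G. Deligiannidis, R. Kohn, *Efficient implementation of Markov chain
Monte Carlo when using an unbiased likelihood estimator*, Biometrika 102 (2015) 295, §2–§3.  The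
pseudo-marginal chain records the additive log-noise `Z = log p̂ − log p` of the recycled estimate;
its extended target is `π̄(θ, z) = π(θ) exp(z) g(z | θ)` and a move `(θ, z) → (ϑ, w)` with a FRESH
noise `w ∼ g` is accepted with probability `min{1, exp(w − z) r_EX(θ, ϑ)}` (§2, eqs. (π̄(θ,z)),
(α_Q)).  Under Assumption 1 (noise law independent of `θ`) the stationary law of the recorded noise
is `π_Z(z) = exp(z) g(z)`; under Assumption 2 — "The noise density is
`g^σ(z) = φ(z; −σ²/2, σ²)`", which "ensures that `∫ exp(z) g^σ(z) dz = 1` as required by the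
unbiasedness of the likelihood estimator" (§3.3) — the printed Corollary 3 (= Lemma 4 of Pitt,
Silva, Giordani, Kohn, J. Econometrics 171 (2012) 134) reads:
"`π_Z^σ(z) = φ(z; σ²/2, σ²)`,
`ϱ_Z^σ(z) = 1 − Φ(z/σ + σ/2) + exp(−z) Φ(z/σ − σ/2)` … Additionally, `π_Z^σ(ϱ_Z^σ) = 2Φ(−σ/√2)`",
where `ϱ_Z(z) = ∫ g(w) min{1, exp(w − z)} dw` is the noise part of the acceptance (§3.1 eq. (α_{Q*}))
and `Φ` the standard normal distribution function; with the perfect proposal (`r_EX ≡ 1`, §3.3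
Remark 2) `π_Z^σ(ϱ_Z^σ) = 2Φ(−σ/√2)` IS the stationary acceptance rate of the pseudo-marginal chain,
and in general `π̄(ϱ_Q) ≥ 2Φ(−σ/√2) π(ϱ_EX)` (§4.3).

Lean reading: `s : ℝ≥0` is the log-noise variance `σ²`; `noiseLaw s = gaussianReal (−s/2) s` is
`g^σ`, `tiltedLaw s = gaussianReal (s/2) s` is `π_Z^σ`; `Φ(t) = (gaussianReal 0 1).real (Iic t)`;
`erfc x = (2/√π) ∫_{u > x} e^{−u²} du` written out (DLMF 7.2.2) as in
`GaussianMetropolisAcceptance.lean`, whose `⟨min(1, e^{−Δ})⟩ = erfc(√(w/8))` for `Δ ∼ N(w/2, w)`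
(Knechtli–Wolff (3.13)) is REUSED with `w = 2σ²`: at stationarity `Z − W ∼ N(σ², 2σ²)`.

Contents (all proved):
* `integral_exp_noiseLaw` — unbiasedness `∫ e^z g^σ(z) dz = 1` (§3.3);
* `exp_mul_gaussianPDFReal_noise`, `noiseLaw_withDensity_exp` — Corollary 3, first clause:
  `e^z φ(z; −σ²/2, σ²) = φ(z; σ²/2, σ²)`, i.e. `π_Z^σ = N(σ²/2, σ²)`;
* `noiseAcceptAt_eq` — Corollary 3, second clause in un-standardised form:
  `ϱ_Z^σ(z) = P(N(−σ²/2, σ²) ≥ z) + e^{−z} P(N(σ²/2, σ²) < z)`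
  (`= 1 − Φ(z/σ + σ/2) + e^{−z} Φ(z/σ − σ/2)`);
* `map_sub_tiltedLaw_prod_noiseLaw` — at stationarity `Z − W ∼ N(σ², 2σ²)` (independent Gaussians);
* `integral_noiseAccept_eq_erfc`, `integral_noiseAccept_eq_two_mul_cdf` — Corollary 3, last clause:
  `π_Z^σ(ϱ_Z^σ) = ∬ min{1, e^{w−z}} g^σ(dw) π_Z^σ(dz) = erfc(σ/2) = 2Φ(−σ/√2)`;
* `integral_noiseAccept_lt_one` — `2Φ(−σ/√2) < 1` for `σ > 0`: with Gaussian log-noise even the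
  perfect proposal cannot reach acceptance `1` (the finite, distribution-free form of this ceiling is
  `Literature/Probability/MarkovChains/PseudoMarginalAcceptance.lean`);
* `integral_noiseAccept_zero` — `σ = 0` (no noise): the value is `1`.

Context: cell pub-lqcd (venture LatticeQCDFlow), R2-SCOPE.md §3 E2 route D2 / §4 C-PM (the
pseudo-marginal fermion-determinant route: "the variance of the noisy estimates … would degrade the
statistical performance achieved by even an optimally trained model",
[cite: AlbergoEtAl2021Fermions, §V]).
-/

namespace Literature.Probability.Distributions

open MeasureTheory ProbabilityTheory Set
open scoped NNReal ENNReal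

-- Grouping namespace naming the model (Doucet–Pitt–Deligiannidis–Kohn's Gaussian log-noise).
namespace PseudoMarginalNoise

variable {s : ℝ≥0}

/-- The Gaussian log-noise law `g^σ = N(−σ²/2, σ²)` of the fresh log-likelihood-estimate error
(`s = σ²`). [cite: DoucetEtAl2015, §3.3 Assumption 2 ("The noise density is
`g^σ(z) = φ(z; −σ²/2, σ²)`")]; [cite: PittEtAl2012, Lemma 4 (as restated in DoucetEtAl2015 Cor. 3)] -/
noncomputable def noiseLaw (s : ℝ≥0) : Measure ℝ := gaussianReal (-((s : ℝ) / 2)) s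

/-- The stationary ("tilted") law `π_Z^σ = N(σ²/2, σ²)` of the RECYCLED log-noise at equilibrium.
[cite: DoucetEtAl2015, Corollary 3 ("`π_Z^σ(z) = φ(z; σ²/2, σ²)`")] -/
noncomputable def tiltedLaw (s : ℝ≥0) : Measure ℝ := gaussianReal ((s : ℝ) / 2) s

/-- `g^σ` is a probability measure. [folklore] -/
instance (s : ℝ≥0) : IsProbabilityMeasure (noiseLaw s) := by
  unfold noiseLaw; infer_instance

/-- `π_Z^σ` is a probability measure. [folklore] -/
instance (s : ℝ≥0) : IsProbabilityMeasure (tiltedLaw s) := by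
  unfold tiltedLaw; infer_instance

/-! ## Unbiasedness and the tilt `π_Z^σ = e^z g^σ(z) = φ(z; σ²/2, σ²)` -/

/-- **Unbiasedness of the estimator in log-noise form**: `∫ exp(z) g^σ(z) dz = 1` — "Assumption 2
ensures that `∫ exp(z) g^σ(z) dz = 1` as required by the unbiasedness of the likelihood estimator"
(the Gaussian moment generating function at `t = 1`: `exp(−σ²/2 + σ²/2) = 1`).
[cite: DoucetEtAl2015, §3.3 (sentence after Assumption 2)] -/
theorem integral_exp_noiseLaw (s : ℝ≥0) : ∫ z, Real.exp z ∂(noiseLaw s) = 1 := by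
  have h := congrFun (mgf_id_gaussianReal (μ := -((s : ℝ) / 2)) (v := s)) 1
  simp only [mgf, id_eq, one_mul] at h
  rw [noiseLaw, h, show -((s : ℝ) / 2) * 1 + (s : ℝ) * 1 ^ 2 / 2 = 0 by ring, Real.exp_zero]

/-- **The tilt at the level of densities**: `exp(z) · φ(z; −σ²/2, σ²) = φ(z; σ²/2, σ²)` (complete the
square: `z − (z + σ²/2)²/(2σ²) = −(z − σ²/2)²/(2σ²)`). [cite: DoucetEtAl2015, Corollary 3 (first
clause, `π_Z^σ(z) = φ(z; σ²/2, σ²)` with `π_Z(z) = exp(z) g(z)` of eq. (π_Z))] -/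
theorem exp_mul_gaussianPDFReal_noise (hs : s ≠ 0) (z : ℝ) :
    Real.exp z * gaussianPDFReal (-((s : ℝ) / 2)) s z = gaussianPDFReal ((s : ℝ) / 2) s z := by
  simp only [gaussianPDFReal_def]
  rw [mul_left_comm, ← Real.exp_add]
  congr 2
  have hs' : (s : ℝ) ≠ 0 := NNReal.coe_ne_zero.mpr hs
  field_simp
  ring

/-- **Corollary 3, first clause**: the stationary law of the recycled log-noise, `π_Z(dz) = e^z g^σ(dz)`,
is the Gaussian `N(σ²/2, σ²)`. [cite: DoucetEtAl2015, §2 eq. (π_Z) (`π_Z(z) = exp(z) g(z)`) and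
Corollary 3 (`π_Z^σ(z) = φ(z; σ²/2, σ²)`)]; [cite: PittEtAl2012, Lemma 4] -/
theorem noiseLaw_withDensity_exp (hs : s ≠ 0) :
    (noiseLaw s).withDensity (fun z => ENNReal.ofReal (Real.exp z)) = tiltedLaw s := by
  rw [noiseLaw, tiltedLaw, gaussianReal_of_var_ne_zero _ hs, gaussianReal_of_var_ne_zero _ hs,
    ← withDensity_mul _ (measurable_gaussianPDF _ _) Real.measurable_exp.ennreal_ofReal]
  congr 1
  funext z
  show gaussianPDF _ _ z * ENNReal.ofReal (Real.exp z) = gaussianPDF _ _ z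
  rw [gaussianPDF, gaussianPDF, ← ENNReal.ofReal_mul (gaussianPDFReal_nonneg _ _ _), mul_comm,
    exp_mul_gaussianPDFReal_noise hs]

/-! ## The conditional noise acceptance `ϱ_Z^σ(z)` -/

/-- For a non-degenerate Gaussian, `(N s).toReal = ∫_s φ` (private helper). [folklore] -/
private theorem toReal_gaussianReal_apply (m : ℝ) {w : ℝ≥0} (hw : w ≠ 0) {t : Set ℝ}
    (ht : MeasurableSet t) :
    (gaussianReal m w t).toReal = ∫ x in t, gaussianPDFReal m w x := by
  rw [gaussianReal_apply_eq_integral m hw t,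
    ENNReal.toReal_ofReal (setIntegral_nonneg ht fun x _ => gaussianPDFReal_nonneg m w x)]

/-- **Corollary 3, second clause (un-standardised)**: the noise part of the acceptance probability
from a recorded log-noise `z`, `ϱ_Z^σ(z) = ∫ g^σ(w) min{1, exp(w − z)} dw`, splits at `w = z` into
`P(W ≥ z) + e^{−z} ∫_{w < z} e^{w} g^σ(w) dw = N(−σ²/2, σ²)[z, ∞) + e^{−z} · N(σ²/2, σ²)(−∞, z)` — the
printed `1 − Φ(z/σ + σ/2) + exp(−z) Φ(z/σ − σ/2)` after standardisation
(`Φ((z − m)/σ) = N(m, σ²)(−∞, z]`). [cite: DoucetEtAl2015, §3.1 eq. (α_{Q*})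
(`ϱ_Z(z) = ∫ g(w) α_Z(z,w) dw`, `α_Z(z,w) = min{1, exp(w − z)}`) and Corollary 3 (`ϱ_Z^σ`)];
[cite: PittEtAl2012, Lemma 4] -/
theorem noiseAcceptAt_eq (hs : s ≠ 0) (z : ℝ) :
    ∫ w, min 1 (Real.exp (w - z)) ∂(noiseLaw s) =
      ((noiseLaw s) (Ici z)).toReal + Real.exp (-z) * ((tiltedLaw s) (Iio z)).toReal := by
  set m : ℝ := -((s : ℝ) / 2) with hm
  rw [noiseLaw, integral_gaussianReal_eq_integral_smul hs]
  simp only [smul_eq_mul]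
  have hf_int : Integrable (fun w => gaussianPDFReal m s w * min 1 (Real.exp (w - z))) := by
    refine (integrable_gaussianPDFReal m s).mono' ?_ (ae_of_all _ fun w => ?_)
    · exact ((measurable_gaussianPDFReal m s).mul
        (measurable_const.min (Real.measurable_exp.comp (measurable_id.sub_const z)))).aestronglyMeasurable
    · rw [Real.norm_eq_abs, abs_of_nonneg (mul_nonneg (gaussianPDFReal_nonneg _ _ _)
        (le_min zero_le_one (Real.exp_pos _).le))]
      exact mul_le_of_le_one_right (gaussianPDFReal_nonneg _ _ _) (min_le_left _ _)
  rw [← integral_add_compl (measurableSet_Ici (a := z)) hf_int]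
  -- piece `w ≥ z`: accepted with probability one
  have h1 : ∫ w in Ici z, gaussianPDFReal m s w * min 1 (Real.exp (w - z)) =
      (gaussianReal m s (Ici z)).toReal := by
    rw [toReal_gaussianReal_apply m hs measurableSet_Ici]
    refine setIntegral_congr_fun measurableSet_Ici fun w hw => ?_
    rw [min_eq_left (Real.one_le_exp (sub_nonneg.mpr hw)), mul_one]
  -- piece `w < z`: the weight `e^{w − z}` tilts `g^σ` into `e^{−z} · N(σ²/2, σ²)`
  have h2 : ∫ w in (Ici z)ᶜ, gaussianPDFReal m s w * min 1 (Real.exp (w - z)) =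
      Real.exp (-z) * (gaussianReal ((s : ℝ) / 2) s (Iio z)).toReal := by
    rw [toReal_gaussianReal_apply _ hs measurableSet_Iio, compl_Ici, ← integral_const_mul]
    refine setIntegral_congr_fun measurableSet_Iio fun w hw => ?_
    have hwz : w - z ≤ 0 := sub_nonpos.mpr (le_of_lt hw)
    rw [min_eq_right (Real.exp_le_one_iff.mpr hwz), sub_eq_add_neg, Real.exp_add, hm,
      ← exp_mul_gaussianPDFReal_noise hs w]
    ring
  rw [h1, h2, hm, tiltedLaw]

/-! ## At stationarity `Z − W ∼ N(σ², 2σ²)` and `π_Z^σ(ϱ_Z^σ) = 2Φ(−σ/√2)` -/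

/-- **The law of `Z − W` at stationarity**: for independent `Z ∼ π_Z^σ = N(σ²/2, σ²)` (recycled) and
`W ∼ g^σ = N(−σ²/2, σ²)` (fresh), `Z − W ∼ N(σ², 2σ²)` — a Gaussian with mean half its variance, the
Knechtli–Wolff form. [cite: DoucetEtAl2015, Corollary 3 (proof ingredients: Assumption 2 and
`π_Z^σ = φ(·; σ²/2, σ²)`)] -/
theorem map_sub_tiltedLaw_prod_noiseLaw (s : ℝ≥0) :
    ((tiltedLaw s).prod (noiseLaw s)).map (fun p : ℝ × ℝ => p.1 - p.2) =
      gaussianReal (s : ℝ) (s + s) := by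
  have h1 : (fun p : ℝ × ℝ => p.1 - p.2) =
      (fun p : ℝ × ℝ => p.1 + p.2) ∘ Prod.map id (fun x : ℝ => -x) := by
    funext p
    simp [sub_eq_add_neg]
  rw [h1, ← Measure.map_map (by fun_prop) (by fun_prop),
    ← Measure.map_prod_map _ _ measurable_id measurable_neg, Measure.map_id, noiseLaw,
    gaussianReal_map_neg, tiltedLaw, ← Measure.conv, gaussianReal_conv_gaussianReal]
  congr 1
  ring

/-- `min(1, e^{−t})` is integrable against any finite measure on `ℝ × ℝ` after composing with
`p ↦ p.1 − p.2` (bounded by `1`; private helper). [folklore] -/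
private theorem integrable_min_one_exp_sub (μ : Measure (ℝ × ℝ)) [IsFiniteMeasure μ] :
    Integrable (fun p : ℝ × ℝ => min 1 (Real.exp (-(p.1 - p.2)))) μ := by
  refine Integrable.mono' (integrable_const (1 : ℝ)) ?_ (ae_of_all _ fun p => ?_)
  · exact (measurable_const.min
      (Real.measurable_exp.comp (measurable_fst.sub measurable_snd).neg)).aestronglyMeasurable
  · rw [Real.norm_eq_abs, abs_of_nonneg (le_min zero_le_one (Real.exp_pos _).le)]
    exact min_le_left _ _

/-- The double integral `∬ min{1, e^{w−z}} g^σ(dw) π_Z^σ(dz)` is the single integral of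
`min{1, e^{−t}}` against the law `N(σ², 2σ²)` of `t = z − w`. [cite: DoucetEtAl2015, Corollary 3
(`π_Z^σ(ϱ_Z^σ)`)] -/
theorem integral_noiseAccept_eq_integral_gaussianReal (s : ℝ≥0) :
    ∫ z, ∫ w, min 1 (Real.exp (w - z)) ∂(noiseLaw s) ∂(tiltedLaw s) =
      ∫ t, min 1 (Real.exp (-t)) ∂(gaussianReal (s : ℝ) (s + s)) := by
  have hφ : Measurable (fun p : ℝ × ℝ => p.1 - p.2) := measurable_fst.sub measurable_snd
  have hF : Measurable (fun t : ℝ => min 1 (Real.exp (-t))) :=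
    measurable_const.min (Real.measurable_exp.comp measurable_neg)
  calc ∫ z, ∫ w, min 1 (Real.exp (w - z)) ∂(noiseLaw s) ∂(tiltedLaw s)
      = ∫ z, ∫ w, min 1 (Real.exp (-(z - w))) ∂(noiseLaw s) ∂(tiltedLaw s) := by
        simp_rw [neg_sub]
    _ = ∫ p, min 1 (Real.exp (-(p.1 - p.2))) ∂((tiltedLaw s).prod (noiseLaw s)) :=
        (integral_prod (fun p : ℝ × ℝ => min 1 (Real.exp (-(p.1 - p.2))))
          (integrable_min_one_exp_sub _)).symm
    _ = ∫ t, min 1 (Real.exp (-t)) ∂(((tiltedLaw s).prod (noiseLaw s)).map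
          (fun p : ℝ × ℝ => p.1 - p.2)) :=
        (integral_map hφ.aemeasurable hF.aestronglyMeasurable).symm
    _ = ∫ t, min 1 (Real.exp (-t)) ∂(gaussianReal (s : ℝ) (s + s)) := by
        rw [map_sub_tiltedLaw_prod_noiseLaw]

/-- `N(σ², 2σ²)` in the "mean = half the variance" parametrisation of
`GaussianMetropolisAcceptance.lean` (private helper). [folklore] -/
private theorem gaussianReal_double_eq (s : ℝ≥0) :
    gaussianReal (s : ℝ) (s + s) = gaussianReal (((s + s : ℝ≥0) : ℝ) / 2) (s + s) := by
  congr 1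
  push_cast
  ring

/-- **Corollary 3, last clause, `erfc` form**: for `σ > 0`,
`π_Z^σ(ϱ_Z^σ) = ∬ min{1, e^{w−z}} g^σ(dw) π_Z^σ(dz) = (2/√π) ∫_{σ/2}^{∞} e^{−u²} du = erfc(σ/2)` — the
stationary probability that the NOISE part of a pseudo-marginal move is accepted; with the perfect
proposal (`r_EX ≡ 1`) this is the acceptance rate of the chain itself.
[cite: DoucetEtAl2015, Corollary 3 ("`π_Z^σ(ϱ_Z^σ) = 2Φ(−σ/√2)`") and §3.3 Remark 2 (arXiv:1210.1871 numbering)];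
[cite: PittEtAl2012, Lemma 4]; [cite: KnechtliWolff2003, §3 eq. (3.13) (the same integral,
`erfc(Σ/2)` for `Δ ∼ N(Σ², 2Σ²)`)] -/
theorem integral_noiseAccept_eq_erfc (hs : s ≠ 0) :
    ∫ z, ∫ w, min 1 (Real.exp (w - z)) ∂(noiseLaw s) ∂(tiltedLaw s) =
      2 / Real.sqrt Real.pi * ∫ u in Ioi (Real.sqrt (s : ℝ) / 2), Real.exp (-u ^ 2) := by
  have hss : s + s ≠ 0 := by simpa using hs
  rw [integral_noiseAccept_eq_integral_gaussianReal, gaussianReal_double_eq,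
    integral_min_one_exp_neg_gaussianReal_eq_erfc hss]
  congr 3
  rw [show ((s + s : ℝ≥0) : ℝ) / 8 = (s : ℝ) / 4 by push_cast; ring,
    Real.sqrt_div' _ (by norm_num : (0 : ℝ) ≤ 4), show (4 : ℝ) = 2 ^ 2 by norm_num,
    Real.sqrt_sq zero_le_two]

/-- Standardisation of a Gaussian distribution function: `N(m, v)(−∞, z] = N(0, 1)(−∞, (z − m)/√v]`,
i.e. `P(X ≤ z) = Φ((z − m)/√v)`. [cite: DoucetEtAl2015, Corollary 3 (the standard Gaussian
cumulative distribution function `Φ` in the printed formulas)] -/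
theorem gaussianReal_Iic_eq_std (m : ℝ) {v : ℝ≥0} (hv : v ≠ 0) (z : ℝ) :
    gaussianReal m v (Iic z) = gaussianReal 0 1 (Iic ((z - m) / Real.sqrt (v : ℝ))) := by
  have hv0 : (0 : ℝ) < v := by exact_mod_cast pos_iff_ne_zero.mpr hv
  have hsv : 0 < Real.sqrt (v : ℝ) := Real.sqrt_pos.mpr hv0
  have h1 : gaussianReal m v = (gaussianReal 0 v).map (· + m) := by
    rw [gaussianReal_map_add_const, zero_add]
  have h2 : gaussianReal 0 v = (gaussianReal 0 1).map (Real.sqrt (v : ℝ) * ·) := by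
    rw [gaussianReal_map_const_mul, mul_zero]
    congr 1
    apply NNReal.eq
    simp [Real.sq_sqrt hv0.le]
  rw [h1, Measure.map_apply (measurable_add_const m) measurableSet_Iic, preimage_add_const_Iic, h2,
    Measure.map_apply (measurable_const_mul _) measurableSet_Iic, preimage_const_mul_Iic₀ _ hsv]

/-- **Corollary 3, last clause, as printed**: for `σ > 0`,
`π_Z^σ(ϱ_Z^σ) = 2 Φ(−σ/√2)` with `Φ` the standard normal distribution function
(`Z − W ∼ N(σ², 2σ²)`, so `P(Z − W ≤ 0) = Φ(−σ²/√(2σ²)) = Φ(−σ/√2)`).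
[cite: DoucetEtAl2015, Corollary 3 ("Additionally, `π_Z^σ(ϱ_Z^σ) = 2Φ(−σ/√2)`")];
[cite: PittEtAl2012, Lemma 4] -/
theorem integral_noiseAccept_eq_two_mul_cdf (hs : s ≠ 0) :
    ∫ z, ∫ w, min 1 (Real.exp (w - z)) ∂(noiseLaw s) ∂(tiltedLaw s) =
      2 * (gaussianReal 0 1 (Iic (-(Real.sqrt (s : ℝ) / Real.sqrt 2)))).toReal := by
  have hss : s + s ≠ 0 := by simpa using hs
  have hs0 : (0 : ℝ) < s := by exact_mod_cast pos_iff_ne_zero.mpr hs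
  rw [integral_noiseAccept_eq_integral_gaussianReal, gaussianReal_double_eq,
    integral_min_one_exp_neg_gaussianReal hss, ← gaussianReal_double_eq,
    gaussianReal_Iic_eq_std _ hss]
  congr 4
  -- `(0 − σ²)/√(2σ²) = −σ/√2`
  have h2s : ((s + s : ℝ≥0) : ℝ) = 2 * (s : ℝ) := by push_cast; ring
  rw [h2s, Real.sqrt_mul' _ hs0.le, zero_sub, neg_div, mul_comm (Real.sqrt 2),
    div_mul_eq_div_div, Real.div_sqrt]

/-- `(2/√π) ∫_{u > 0} e^{−u²} du = 1` (`erfc 0 = 1`; private helper). [folklore] -/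
private theorem two_div_sqrt_pi_mul_integral_Ioi_zero :
    2 / Real.sqrt Real.pi * ∫ u in Ioi (0 : ℝ), Real.exp (-u ^ 2) = 1 := by
  have h := integral_gaussian_Ioi (1 : ℝ)
  simp only [neg_mul, one_mul, div_one] at h
  rw [h]
  have hpi : Real.sqrt Real.pi ≠ 0 := (Real.sqrt_pos.mpr Real.pi_pos).ne'
  field_simp

/-- **The Gaussian-noise ceiling is non-trivial**: for `σ > 0`, `2Φ(−σ/√2) = erfc(σ/2) < 1` — with
Gaussian log-noise of positive variance the pseudo-marginal chain cannot accept every move even with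
the perfect proposal (`ϱ_EX ≡ 1`). [cite: DoucetEtAl2015, Corollary 3 with §3.3 Remark 2 (arXiv:1210.1871 numbering)];
[cite: AlbergoEtAl2021Fermions, §V ("the variance of the noisy estimates … would degrade the
statistical performance achieved by even an optimally trained model")] -/
theorem integral_noiseAccept_lt_one (hs : s ≠ 0) :
    ∫ z, ∫ w, min 1 (Real.exp (w - z)) ∂(noiseLaw s) ∂(tiltedLaw s) < 1 := by
  rw [integral_noiseAccept_eq_erfc hs, ← two_div_sqrt_pi_mul_integral_Ioi_zero]
  have hs0 : (0 : ℝ) < s := by exact_mod_cast pos_iff_ne_zero.mpr hs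
  set a : ℝ := Real.sqrt (s : ℝ) / 2 with ha
  have ha0 : 0 < a := by rw [ha]; exact div_pos (Real.sqrt_pos.mpr hs0) two_pos
  have hpi : 0 < 2 / Real.sqrt Real.pi := div_pos two_pos (Real.sqrt_pos.mpr Real.pi_pos)
  refine mul_lt_mul_of_pos_left ?_ hpi
  -- `∫_{u > a} e^{−u²} < ∫_{u > 0} e^{−u²}` since the integrand is positive on `(0, a]`
  have hint : Integrable (fun u : ℝ => Real.exp (-u ^ 2)) := by
    simpa using integrable_exp_neg_mul_sq (b := (1 : ℝ)) one_pos
  have hsplit : ∫ u in Ioi (0 : ℝ), Real.exp (-u ^ 2) =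
      (∫ u in Ioc (0 : ℝ) a, Real.exp (-u ^ 2)) + ∫ u in Ioi a, Real.exp (-u ^ 2) := by
    rw [← setIntegral_union (Ioc_disjoint_Ioi le_rfl) measurableSet_Ioi hint.integrableOn
      hint.integrableOn, Ioc_union_Ioi_eq_Ioi ha0.le]
  have hpos : 0 < ∫ u in Ioc (0 : ℝ) a, Real.exp (-u ^ 2) := by
    rw [setIntegral_pos_iff_support_of_nonneg_ae (ae_of_all _ fun u => (Real.exp_pos _).le)
      hint.integrableOn]
    have hsupp : Function.support (fun u : ℝ => Real.exp (-u ^ 2)) = univ := by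
      ext u
      simp [Real.exp_ne_zero]
    rw [hsupp, univ_inter, Real.volume_Ioc, sub_zero, ENNReal.ofReal_pos]
    exact ha0
  linarith

/-- **No noise, no loss**: for `σ = 0` both laws are the point mass at `0` and the value is `1`.
[cite: DoucetEtAl2015, §3.1 (`α_Z(z,w) = min{1, exp(w − z)}` equals `1` when `w = z`)] -/
theorem integral_noiseAccept_zero :
    ∫ z, ∫ w, min 1 (Real.exp (w - z)) ∂(noiseLaw 0) ∂(tiltedLaw 0) = 1 := by
  simp [noiseLaw, tiltedLaw, integral_dirac]

end PseudoMarginalNoise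

end Literature.Probability.Distributions
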